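import Summits.QuantumFields.YangMills.Theorems.UnitScaleTiltProp7WordLetters
import Summits.QuantumFields.YangMills.Theorems.UnitScaleTiltProp7WordLettersRev
import Literature.MathematicalPhysics.QuantumFieldTheory.Balaban1983to89.BlockAveragingEMLProp2
import HarnessLib

/-!
# Route `UnitScaleTilt`, crux K1 child «MinimiserStabilityRegPr» (stmt-QuantumFields-19200), line «route-R», growth side — THE (0.4) LOOP WORD AS FOUR STEP BLOCKS
# `Γ ⧺ [x,x′] ⧺ flip-rev Γ′ ⧺ flip-rev c` AND ITS LETTER FAMILY BLOCK BY BLOCK (the instantiation of the three∕four-piece commutator split on ONE symmetric averaging word)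

Cell `ym3-torus`, twin width seat `ym-routeR-w1` (g3); row (w1-o1′) NAMED by the route-R lead `ym-ust-19200-p1` (g13, 13:33:15Z∕13:37:23Z «§2 instantiation on ONE
symmetric (0.4) word»); sequel of ✓ `…Prop7WordLetters` (letters `Λ_t`, sum = `covWalkSum`, holonomy ratio = ordered product, `letter_append_left∕right`) and
✓ `…Prop7WordLettersRev` (`walk_walkEnd_wordRev`, `letter_reverse_flip`).  THEOREMS ONLY (0 `def`, 0 `sorry`); `--supports stmt-QuantumFields-19200 --as helper`,
count-neutral.  YM₃ on T³ is a ladder rung (R3), not the Clay problem; nothing here claims stub S, row E′, the crux or the gap.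

WHAT IS PROVED (ns `…Theorems.Prop7WordLettersLoop`; `c` a coarse bond, `i = (r, σ, σ′) ∈ Idx P`, `n = off r`, `x = walkEnd (emb c₋) Γ^σ(n)`; flip = `⟨s.bond, !s.fwd⟩`).
* §1 ★★ `walk_loopWord_eq` — `walk (emb c₋) (loopWord L μ_c n σ σ′) = walk (emb c₋) Γ^σ(n) ⧺ (walk x [L steps +e_μ] ⧺ (flip-rev (walk (emb c₊) Γ^{σ′}(n)) ⧺
  flip-rev (walk (emb c₋) [L steps +e_μ])))` (✓ `walk_append`, ✓ `walkEnd_stairWord_replicate`, ✓ `walkEnd_replicate_L`, ✓ `walk_walkEnd_wordRev`); `length_flipRev`.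
* §2 the letters of the loop walk, block by block (ℕ-indexed, any step-letter map `Z` for the forward blocks, `covStep` for the reversed ones):
  `loopLetter_block1` (`t < |Γ|`: the leg letter), `loopLetter_block2` (`t = |Γ| + u`, `u < L`: `Ad_{U₀(Γ)}` of the segment letter),
  ★★ `loopLetter_block3` (`t = |Γ| + (L + v)`, `v < |Γ′|`: `−Ad_{U₀(Γ)U₀([x,x′])U₀(Γ′)⁻¹}` of the `(|Γ′|−(v+1))`-th letter of the translated leg `Γ′`),
  ★★ `loopLetter_block4` (`t = |Γ| + (L + (|Γ′| + z))`, `z < L`: `−Ad_{U₀(Γ)U₀([x,x′])U₀(Γ′)⁻¹U₀(c)⁻¹}` of the `(L−(z+1))`-th letter of the axis `[emb c₋, emb c₊]`).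
So, read on `Fin (|Γ| + (L + (|Γ′| + L)))`, the loop's letter family is `F ⧺ Ad S ⧺ rev(−Ad F′) ⧺ rev(−Ad Ax)` with FIXED `SU(N)` transports — the input of
✓ `Prop7WordCommutatorSplit.commSum_threePiece ∕ commSum_fourPiece` after ✓ `Prop7WordLetters.commSum_conj` pulls the transports out of each block.
HONEST SCOPE.  Bookkeeping only; the commutator-sum expansion itself and all estimates are the cited files'.

References: T. Bałaban, CMP 109 (1987) 249–301 [Balaban1987RG1] ((0.3)–(0.4) pp.252–253); CMP 98 (1985) 17–51 [Balaban1985Averaging] ((56)–(58) p.27).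
-/

noncomputable section

open scoped BigOperators Matrix.Norms.L2Operator

namespace Summit.QuantumFields.YangMills.Theorems.Prop7WordLettersLoop

open Literature.MathematicalPhysics.QuantumFieldTheory.Balaban1983to89
open Finset T4Continuum BlockAveraging BlockAveragingEMLLinearised BlockAveragingEMLLinearisedBackground BlockAveragingEMLProp2
open Summit.QuantumFields.YangMills.Theorems.Prop7WordLetters (letter_append_left letter_append_right)
open Summit.QuantumFields.YangMills.Theorems.Prop7WordLettersRev (walk_walkEnd_wordRev letter_reverse_flip holAt_map_flip_reverse)

variable {P : Params} {n : Type*} [Fintype n] [DecidableEq n] [Nonempty n] {j : ℕ}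

/-! ## §1 The loop walk as four step blocks -/

omit [Fintype n] [DecidableEq n] [Nonempty n] in
/-- ★★ **THE (0.4) LOOP WALK IS FOUR STEP BLOCKS**: leg `Γ^σ` from `emb c₋`, the straight segment of `L` steps from its end `x`, the flipped reverse of the leg `Γ^{σ′}`
from `emb c₊` (which ends at `x′ = x + Le_μ`), and the flipped reverse of the axis `[emb c₋ → emb c₊]`. [cite: Balaban1987RG1, (0.4) p.253] -/
theorem walk_loopWord_eq (c : PBond P (j + 1)) (i : Idx P) :
    walk (emb c.src) (loopWord P.L c.dir (off i.1) i.2.1 i.2.2)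
      = walk (emb c.src) (stairWord i.2.1 (off i.1))
        ++ (walk (walkEnd (emb c.src) (stairWord i.2.1 (off i.1))) (List.replicate P.L (c.dir, true))
          ++ (((walk (emb c.tgt) (stairWord i.2.2 (off i.1))).map fun s : LStep P j => (⟨s.bond, !s.fwd⟩ : LStep P j)).reverse
            ++ ((walk (emb c.src) (List.replicate P.L (c.dir, true))).map fun s : LStep P j => (⟨s.bond, !s.fwd⟩ : LStep P j)).reverse)) := by
  unfold loopWord
  rw [walk_append, walk_append, walk_append, walkEnd_stairWord_replicate c.src c.dir i.2.1 i.2.2 (off i.1),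
    show c.src.shift c.dir = c.tgt from rfl, walk_walkEnd_wordRev, walkEnd_walkEnd_wordRev,
    show List.replicate P.L (c.dir, false) = wordRev (List.replicate P.L (c.dir, true)) by rw [wordRev_replicate]; rfl,
    show emb c.tgt = walkEnd (emb c.src) (List.replicate P.L (c.dir, true)) from (walkEnd_replicate_L c.src c.dir).symm, walk_walkEnd_wordRev]

omit [Fintype n] [DecidableEq n] [Nonempty n] in
/-- The flipped reverse of a step list has the same length. [folklore] -/
theorem length_flipRev (Γ : List (LStep P j)) :
    ((Γ.map fun s : LStep P j => (⟨s.bond, !s.fwd⟩ : LStep P j)).reverse).length = Γ.length := by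
  rw [List.length_reverse, List.length_map]

/-! ## §2 The letters of the loop walk, block by block -/

/-- Block 1 (`t < |Γ|`): the loop's `t`-th letter is the leg's `t`-th letter. [cite: Balaban1987RG1, (0.4) p.253] -/
theorem loopLetter_block1 (U₀ : GaugeField P j (Matrix.specialUnitaryGroup n ℂ)) (Z : LStep P j → Matrix n n ℂ)
    (Γ S R A : List (LStep P j)) {t : ℕ} (ht : t < Γ.length) :
    ((holAt U₀ ((Γ ++ (S ++ (R ++ A))).take t) : Matrix.specialUnitaryGroup n ℂ) : Matrix n n ℂ) * (((Γ ++ (S ++ (R ++ A)))[t]?).map Z).getD 0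
        * star ((holAt U₀ ((Γ ++ (S ++ (R ++ A))).take t) : Matrix.specialUnitaryGroup n ℂ) : Matrix n n ℂ)
      = ((holAt U₀ (Γ.take t) : Matrix.specialUnitaryGroup n ℂ) : Matrix n n ℂ) * ((Γ[t]?).map Z).getD 0
        * star ((holAt U₀ (Γ.take t) : Matrix.specialUnitaryGroup n ℂ) : Matrix n n ℂ) :=
  letter_append_left U₀ Z Γ _ ht

/-- Block 2 (`t = |Γ| + u`, `u < |S|`): `Ad_{U₀(Γ)}` of the segment's `u`-th letter. [cite: Balaban1987RG1, (0.4) p.253] -/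
theorem loopLetter_block2 (U₀ : GaugeField P j (Matrix.specialUnitaryGroup n ℂ)) (Z : LStep P j → Matrix n n ℂ)
    (Γ S R A : List (LStep P j)) {u : ℕ} (hu : u < S.length) :
    ((holAt U₀ ((Γ ++ (S ++ (R ++ A))).take (Γ.length + u)) : Matrix.specialUnitaryGroup n ℂ) : Matrix n n ℂ)
        * (((Γ ++ (S ++ (R ++ A)))[Γ.length + u]?).map Z).getD 0
        * star ((holAt U₀ ((Γ ++ (S ++ (R ++ A))).take (Γ.length + u)) : Matrix.specialUnitaryGroup n ℂ) : Matrix n n ℂ)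
      = ((holAt U₀ Γ : Matrix.specialUnitaryGroup n ℂ) : Matrix n n ℂ)
        * (((holAt U₀ (S.take u) : Matrix.specialUnitaryGroup n ℂ) : Matrix n n ℂ) * ((S[u]?).map Z).getD 0
            * star ((holAt U₀ (S.take u) : Matrix.specialUnitaryGroup n ℂ) : Matrix n n ℂ))
        * star ((holAt U₀ Γ : Matrix.specialUnitaryGroup n ℂ) : Matrix n n ℂ) := by
  rw [letter_append_right U₀ Z Γ (S ++ (R ++ A)) u, letter_append_left U₀ Z S _ hu]

/-- ★★ Block 3 (`t = |Γ| + (|S| + v)`, `v < |Γ′|`), for the REVERSED FLIPPED leg `R = flip-rev Γ′`: minus the `(|Γ′|−(v+1))`-th letter of `Γ′`, transported by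
`U₀(Γ)·U₀(S)·U₀(Γ′)⁻¹` (first-order letters `covStep`). [cite: Balaban1987RG1, (0.4) p.253; Balaban1985Averaging, (58) p.27] -/
theorem loopLetter_block3 (U₀ : GaugeField P j (Matrix.specialUnitaryGroup n ℂ)) (Y : PBond P j → Matrix n n ℂ)
    (Γ S Γ' A : List (LStep P j)) {v : ℕ} (hv : v < Γ'.length) :
    ((holAt U₀ ((Γ ++ (S ++ (((Γ'.map fun s : LStep P j => (⟨s.bond, !s.fwd⟩ : LStep P j)).reverse) ++ A))).take (Γ.length + (S.length + v))) :
          Matrix.specialUnitaryGroup n ℂ) : Matrix n n ℂ)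
        * (((Γ ++ (S ++ (((Γ'.map fun s : LStep P j => (⟨s.bond, !s.fwd⟩ : LStep P j)).reverse) ++ A)))[Γ.length + (S.length + v)]?).map
            (covStep U₀ Y)).getD 0
        * star ((holAt U₀ ((Γ ++ (S ++ (((Γ'.map fun s : LStep P j => (⟨s.bond, !s.fwd⟩ : LStep P j)).reverse) ++ A))).take (Γ.length + (S.length + v))) :
          Matrix.specialUnitaryGroup n ℂ) : Matrix n n ℂ)
      = -(((holAt U₀ Γ * holAt U₀ S * (holAt U₀ Γ')⁻¹ : Matrix.specialUnitaryGroup n ℂ) : Matrix n n ℂ)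
          * (((holAt U₀ (Γ'.take (Γ'.length - (v + 1))) : Matrix.specialUnitaryGroup n ℂ) : Matrix n n ℂ)
              * ((Γ'[Γ'.length - (v + 1)]?).map (covStep U₀ Y)).getD 0
              * star ((holAt U₀ (Γ'.take (Γ'.length - (v + 1))) : Matrix.specialUnitaryGroup n ℂ) : Matrix n n ℂ))
          * star (((holAt U₀ Γ * holAt U₀ S * (holAt U₀ Γ')⁻¹ : Matrix.specialUnitaryGroup n ℂ) : Matrix n n ℂ))) := by
  have hv' : v < ((Γ'.map fun s : LStep P j => (⟨s.bond, !s.fwd⟩ : LStep P j)).reverse).length := by rwa [length_flipRev]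
  rw [letter_append_right U₀ (covStep U₀ Y) Γ _ (S.length + v), letter_append_right U₀ (covStep U₀ Y) S _ v,
    letter_append_left U₀ (covStep U₀ Y) _ A hv', letter_reverse_flip U₀ Y Γ' hv]
  have hinv : (((holAt U₀ Γ')⁻¹ : Matrix.specialUnitaryGroup n ℂ) : Matrix n n ℂ) = star ((holAt U₀ Γ' : Matrix.specialUnitaryGroup n ℂ) : Matrix n n ℂ) := rfl
  rw [Submonoid.coe_mul, Submonoid.coe_mul, hinv, star_mul, star_mul, star_star]
  noncomm_ring

/-- ★★ Block 4 (`t = |Γ| + (|S| + (|R| + z))`, `z < |A₀|`), for the REVERSED FLIPPED axis `A = flip-rev A₀`: minus the `(|A₀|−(z+1))`-th letter of `A₀`, transported by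
`U₀(Γ)·U₀(S)·U₀(R)·U₀(A₀)⁻¹`. [cite: Balaban1987RG1, (0.4) p.253; Balaban1985Averaging, (58) p.27] -/
theorem loopLetter_block4 (U₀ : GaugeField P j (Matrix.specialUnitaryGroup n ℂ)) (Y : PBond P j → Matrix n n ℂ)
    (Γ S R A₀ : List (LStep P j)) {z : ℕ} (hz : z < A₀.length) :
    ((holAt U₀ ((Γ ++ (S ++ (R ++ ((A₀.map fun s : LStep P j => (⟨s.bond, !s.fwd⟩ : LStep P j)).reverse)))).take (Γ.length + (S.length + (R.length + z)))) :
          Matrix.specialUnitaryGroup n ℂ) : Matrix n n ℂ)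
        * (((Γ ++ (S ++ (R ++ ((A₀.map fun s : LStep P j => (⟨s.bond, !s.fwd⟩ : LStep P j)).reverse))))[Γ.length + (S.length + (R.length + z))]?).map
            (covStep U₀ Y)).getD 0
        * star ((holAt U₀ ((Γ ++ (S ++ (R ++ ((A₀.map fun s : LStep P j => (⟨s.bond, !s.fwd⟩ : LStep P j)).reverse)))).take
            (Γ.length + (S.length + (R.length + z)))) : Matrix.specialUnitaryGroup n ℂ) : Matrix n n ℂ)
      = -(((holAt U₀ Γ * holAt U₀ S * holAt U₀ R * (holAt U₀ A₀)⁻¹ : Matrix.specialUnitaryGroup n ℂ) : Matrix n n ℂ)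
          * (((holAt U₀ (A₀.take (A₀.length - (z + 1))) : Matrix.specialUnitaryGroup n ℂ) : Matrix n n ℂ)
              * ((A₀[A₀.length - (z + 1)]?).map (covStep U₀ Y)).getD 0
              * star ((holAt U₀ (A₀.take (A₀.length - (z + 1))) : Matrix.specialUnitaryGroup n ℂ) : Matrix n n ℂ))
          * star (((holAt U₀ Γ * holAt U₀ S * holAt U₀ R * (holAt U₀ A₀)⁻¹ : Matrix.specialUnitaryGroup n ℂ) : Matrix n n ℂ))) := by
  have hz' : z < ((A₀.map fun s : LStep P j => (⟨s.bond, !s.fwd⟩ : LStep P j)).reverse).length := by rwa [length_flipRev]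
  rw [letter_append_right U₀ (covStep U₀ Y) Γ _ (S.length + (R.length + z)), letter_append_right U₀ (covStep U₀ Y) S _ (R.length + z),
    letter_append_right U₀ (covStep U₀ Y) R _ z]
  rw [letter_reverse_flip U₀ Y A₀ hz]
  have hinv : (((holAt U₀ A₀)⁻¹ : Matrix.specialUnitaryGroup n ℂ) : Matrix n n ℂ) = star ((holAt U₀ A₀ : Matrix.specialUnitaryGroup n ℂ) : Matrix n n ℂ) := rfl
  rw [Submonoid.coe_mul, Submonoid.coe_mul, Submonoid.coe_mul, hinv, star_mul, star_mul, star_mul, star_star]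
  noncomm_ring

end Summit.QuantumFields.YangMills.Theorems.Prop7WordLettersLoop

end
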